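import Mathlib
import HarnessLib

/-!
# Crux `NNMonotoneHard` (stmt-ValiantsHypothesis-11617), piece (D) of `Cruxes/NNMonotoneHard/PROOF-PLAN.md`:
# a balanced colouring respected by a thick queue has many colour boundaries

The deterministic heart of the thick-queue measure argument, on an ABSTRACT queue history indexed
by `ℕ` (instantiated later by the ranks of a padded ballot word): letters `W t` (`true` = push /
opener), opener and closer ranks `rO t = #openers<t`, `rC t = #closers<t` (step functions), the
`k`-th opener / closer times `o k`, `c k` (characterised by `o k < t ↔ k < rO t`,
`c k < t ↔ k < rC t`), and a colouring `σ` RESPECTED by the FIFO pairing (`σ (o k) = σ (c k)`).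
The queue at time `t` is the index interval `[rC t, rO t)`, of length `q t = rO t − rC t`.
THICK means: on the window `[A, E]` the length stays in `[L − m, L + m]`.

* `rank_add` — `rO t + rC t = t`; `opener_at`, `closer_at` — a push at time `t` opens arc `rO t`,
  a pop at time `t` closes arc `rC t` (the front).
* `mono_queue_of_mono_interval` — **(D2)** on a monochromatic time interval of length
  `≥ 2L + 4m + 2` inside the thick window, every arc in the queue at any time of the interval has
  the interval's colour (arcs present at the start close inside it; arcs pushed in it open in it).
* `count_other_step` — **(D3)** the number `N_x(t)` of queue arcs NOT of colour `x` changes by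
  `[σ t ≠ x] · (q(t+1) − q(t))` (pushes add their own colour; by respect, pops remove the colour
  of the popping time).
* `count_other_le` — the potential argument: starting from an all-`x` queue right after an
  `x`-time, `N_x(t) + [σ(t−1) ≠ x](L − m) ≤ 2m · #{boundaries into x in between} + [σ(t−1) ≠ x] q(t)`.
* `many_boundaries_of_two_colours` — hence between an all-`x` moment and a later all-`¬x` moment
  there are at least `(L − 3m) / (2m)` boundaries into `x`.

The block/case analysis ((D4): no long monochromatic block / one colour only / both colours) is
assembled with the measure in the final file.  Honest framing: elementary combinatorics of one
queue; VP ≠ VNP is not moved by anything here.  No definitions, no named facts.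
-/

-- Sub = Summit single-conjunct layout: the duplicated namespace component is mandated by the tree.
set_option linter.dupNamespace false

namespace Summit.ValiantsHypothesis.ValiantsHypothesis.Theorems.FifoMatching.NNMonotoneHard

open Finset

section AbstractQueue

/-! ### The abstract queue history -/

variable {W σ : ℕ → Bool} {rO rC o c : ℕ → ℕ} {n' : ℕ}
variable (hO0 : rO 0 = 0) (hC0 : rC 0 = 0)
  (hOs : ∀ t, rO (t + 1) = rO t + (if W t = true then 1 else 0))
  (hCs : ∀ t, rC (t + 1) = rC t + (if W t = true then 0 else 1))
  (ho : ∀ k t, k < n' → (o k < t ↔ k < rO t))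
  (hc : ∀ k t, k < n' → (c k < t ↔ k < rC t))
  (hresp : ∀ k, k < n' → σ (o k) = σ (c k))

include hO0 hC0 hOs hCs in
/-- `#openers<t + #closers<t = t`. [folklore] -/
theorem rank_add (t : ℕ) : rO t + rC t = t := by
  induction t with
  | zero => rw [hO0, hC0]
  | succ t ih => rw [hOs, hCs]; split_ifs <;> omega

include hOs in
/-- The opener rank is monotone. [folklore] -/
theorem rankO_mono {s t : ℕ} (hst : s ≤ t) : rO s ≤ rO t := by
  induction hst with
  | refl => exact le_rfl
  | step _ ih => exact ih.trans (by rw [hOs]; omega)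

include hCs in
/-- The closer rank is monotone. [folklore] -/
theorem rankC_mono {s t : ℕ} (hst : s ≤ t) : rC s ≤ rC t := by
  induction hst with
  | refl => exact le_rfl
  | step _ ih => exact ih.trans (by rw [hCs]; omega)

include hOs ho in
/-- **A push at time `t` opens the arc of index `rO t`.** [folklore] -/
theorem opener_at {t : ℕ} (hW : W t = true) (hn : rO t < n') : o (rO t) = t := by
  have h1 : ¬ o (rO t) < t := fun h => lt_irrefl _ ((ho _ _ hn).1 h)
  have h2 : o (rO t) < t + 1 := (ho _ _ hn).2 (by rw [hOs, if_pos hW]; omega)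
  omega

include hCs hc in
/-- **A pop at time `t` closes the arc of index `rC t` (the front of the queue).** [folklore] -/
theorem closer_at {t : ℕ} (hW : W t = false) (hn : rC t < n') : c (rC t) = t := by
  have h1 : ¬ c (rC t) < t := fun h => lt_irrefl _ ((hc _ _ hn).1 h)
  have h2 : c (rC t) < t + 1 := (hc _ _ hn).2 (by rw [hCs, hW]; simp)
  omega

/-! ### (D2) long monochromatic intervals force a monochromatic queue -/

include hO0 hC0 hOs hCs ho hc hresp in
/-- **(D2)** Let `[s, e)` be a time interval on which `σ` is constantly `x`, with
`e ≥ s + 2L + 4m + 2`, queue lengths at most `L + m` at `s` and at `e`, and `rO e ≤ n'`.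
Then every arc in the queue at any time `t ∈ [s, e]` has colour `x`: an arc present at time `s`
is popped before `e` (enough pops happen), at an `x`-time, so its opener is `x` by respect; an
arc pushed during the interval is opened at an `x`-time. [folklore] -/
theorem mono_queue_of_mono_interval {x : Bool} {s e L m : ℕ} (hse : s + 2 * L + 4 * m + 2 ≤ e)
    (hn : rO e ≤ n')
    (hqs : rO s ≤ rC s + L + m) (hqe : rO e ≤ rC e + L + m)
    (hmono : ∀ t, s ≤ t → t < e → σ t = x)
    {t : ℕ} (hst : s ≤ t) (hte : t ≤ e) {k : ℕ} (hk1 : rC t ≤ k) (hk2 : k < rO t) :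
    σ (o k) = x := by
  have hadd_s := rank_add hO0 hC0 hOs hCs s
  have hadd_e := rank_add hO0 hC0 hOs hCs e
  have hkn : k < n' := lt_of_lt_of_le hk2 ((rankO_mono hOs hte).trans hn)
  by_cases hks : k < rO s
  · -- present at time `s`: closes inside `[s, e)`
    have hks' : rC s ≤ k := (rankC_mono hCs hst).trans hk1
    have hc1 : ¬ c k < s := fun h' => absurd ((hc k s hkn).1 h') (not_lt.2 hks')
    have hc2 : c k < e := by
      rw [hc k e hkn]
      -- `rC e ≥ rC s + L + m + 1 > k`
      omega
    rw [hresp k hkn]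
    exact hmono (c k) (not_lt.1 hc1) hc2
  · -- pushed during `[s, t)`: opened inside `[s, e)`
    have ho1 : ¬ o k < s := fun h' => hks ((ho k s hkn).1 h')
    have ho2 : o k < t := (ho k t hkn).2 hk2
    exact hmono (o k) (not_lt.1 ho1) (lt_of_lt_of_le ho2 hte)

/-! ### (D3) the count of off-colour arcs in the queue -/

include hOs hCs ho hc hresp in
/-- **(D3), one step.**  Let `N(t) = #{k ∈ [rC t, rO t) : σ (o k) ≠ x}` be the number of queue
arcs not of colour `x`.  A push at time `t` adds the arc `rO t` of colour `σ t`; a pop removes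
the front arc `rC t`, whose colour is `σ t` by respect.  Hence
`N(t+1) + [σ t ≠ x ∧ pop] = N(t) + [σ t ≠ x ∧ push]`. [folklore] -/
theorem count_other_step (x : Bool) {t : ℕ} (hn : rO (t + 1) ≤ n') (hbal : rC (t + 1) ≤ rO (t + 1))
    (hbal' : rC t ≤ rO t) :
    ((range n').filter fun k => rC (t + 1) ≤ k ∧ k < rO (t + 1) ∧ σ (o k) ≠ x).card
        + (if σ t ≠ x ∧ W t = false then 1 else 0)
      = ((range n').filter fun k => rC t ≤ k ∧ k < rO t ∧ σ (o k) ≠ x).card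
        + (if σ t ≠ x ∧ W t = true then 1 else 0) := by
  classical
  cases hW : W t
  · -- pop: the arc `rC t` leaves
    have hOs' : rO (t + 1) = rO t := by rw [hOs t, hW]; simp
    have hCs' : rC (t + 1) = rC t + 1 := by rw [hCs t, hW]; simp
    simp only [Bool.false_eq_true, and_false, if_false, add_zero, and_true]
    have hkn : rC t < n' := by omega
    have hcol : σ (o (rC t)) = σ t := by
      rw [hresp _ hkn, closer_at hCs hc hW hkn]
    have hset : ((range n').filter fun k => rC t ≤ k ∧ k < rO t ∧ σ (o k) ≠ x)
        = ((range n').filter fun k => rC (t + 1) ≤ k ∧ k < rO (t + 1) ∧ σ (o k) ≠ x) ∪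
          (if σ t ≠ x then {rC t} else ∅) := by
      ext k
      simp only [mem_filter, mem_range, mem_union]
      split_ifs with hσ
      · simp only [mem_singleton]
        constructor
        · rintro ⟨hk, h1, h2, h3⟩
          by_cases hkk : k = rC t
          · exact Or.inr hkk
          · exact Or.inl ⟨hk, by omega, by omega, h3⟩
        · rintro (⟨hk, h1, h2, h3⟩ | rfl)
          · exact ⟨hk, by omega, by omega, h3⟩
          · exact ⟨hkn, le_rfl, by omega, by rw [hcol]; exact hσ⟩
      · simp only [notMem_empty, or_false]
        constructor
        · rintro ⟨hk, h1, h2, h3⟩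
          have hkk : k ≠ rC t := by rintro rfl; exact hσ (by rw [← hcol]; exact h3)
          exact ⟨hk, by omega, by omega, h3⟩
        · rintro ⟨hk, h1, h2, h3⟩
          exact ⟨hk, by omega, by omega, h3⟩
    rw [hset]
    split_ifs with hσ
    · rw [card_union_of_disjoint, card_singleton]
      rw [disjoint_singleton_right, mem_filter]
      omega
    · rw [union_empty, add_zero]
  · -- push: the arc `rO t` enters
    have hOs' : rO (t + 1) = rO t + 1 := by rw [hOs t, hW]; simp
    have hCs' : rC (t + 1) = rC t := by rw [hCs t, hW]; simp
    simp only [and_true, Bool.true_eq_false, and_false, if_false, add_zero]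
    have hkn : rO t < n' := by omega
    have hcol : σ (o (rO t)) = σ t := by rw [opener_at hOs ho hW hkn]
    have hset : ((range n').filter fun k => rC (t + 1) ≤ k ∧ k < rO (t + 1) ∧ σ (o k) ≠ x)
        = ((range n').filter fun k => rC t ≤ k ∧ k < rO t ∧ σ (o k) ≠ x) ∪
          (if σ t ≠ x then {rO t} else ∅) := by
      ext k
      simp only [mem_filter, mem_range, mem_union]
      split_ifs with hσ
      · simp only [mem_singleton]
        constructor
        · rintro ⟨hk, h1, h2, h3⟩
          by_cases hkk : k = rO t
          · exact Or.inr hkk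
          · exact Or.inl ⟨hk, by omega, by omega, h3⟩
        · rintro (⟨hk, h1, h2, h3⟩ | rfl)
          · exact ⟨hk, by omega, by omega, h3⟩
          · refine ⟨hkn, by omega, by omega, by rw [hcol]; exact hσ⟩
      · simp only [notMem_empty, or_false]
        constructor
        · rintro ⟨hk, h1, h2, h3⟩
          have hkk : k ≠ rO t := by rintro rfl; exact hσ (by rw [← hcol]; exact h3)
          exact ⟨hk, by omega, by omega, h3⟩
        · rintro ⟨hk, h1, h2, h3⟩
          exact ⟨hk, by omega, by omega, h3⟩
    rw [hset]
    split_ifs with hσ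
    · rw [card_union_of_disjoint, card_singleton]
      rw [disjoint_singleton_right, mem_filter]
      omega
    · rw [union_empty, add_zero]

include hOs hCs ho hc hresp in
/-- **The potential argument.**  Suppose the queue is entirely `x`-coloured at time `e`
(`N(e) = 0`), `σ (e − 1) = x` (`e ≥ 1`), the queue lengths stay in `[L − m, L + m]` on `[e, E]`
and `rO E ≤ n'`.  Then for every `t ∈ [e, E]`:
`N(t) + [σ(t−1) ≠ x](L − m) ≤ 2m · #{u ∈ (e, t) : σ(u−1) ≠ x, σ u = x} + [σ(t−1) ≠ x] · q(t)`:
inside an `¬x`-run `N` moves with `q`; inside an `x`-run it is frozen; entering an `¬x`-run costs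
nothing since `q ≥ L − m`; leaving one banks at most `q − (L − m) ≤ 2m`. [folklore] -/
theorem count_other_le (x : Bool) {e E L m : ℕ} (hn : rO E ≤ n')
    (hband : ∀ t, e ≤ t → t ≤ E → L ≤ rO t - rC t + m ∧ rO t ≤ rC t + L + m ∧ rC t ≤ rO t)
    (hσe : σ (e - 1) = x)
    (hNe : ((range n').filter fun k => rC e ≤ k ∧ k < rO e ∧ σ (o k) ≠ x).card = 0)
    {t : ℕ} (het : e ≤ t) (htE : t ≤ E) :
    ((range n').filter fun k => rC t ≤ k ∧ k < rO t ∧ σ (o k) ≠ x).card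
        + (if σ (t - 1) ≠ x then L - m else 0)
      ≤ 2 * m * ((range t).filter fun u => e < u ∧ σ (u - 1) ≠ x ∧ σ u = x).card
        + (if σ (t - 1) ≠ x then rO t - rC t else 0) := by
  classical
  induction t, het using Nat.le_induction with
  | base =>
    rw [hNe, if_neg (by rw [hσe]; exact fun h => h rfl), if_neg (by rw [hσe]; exact fun h => h rfl)]
    simp
  | succ t het ih =>
    have ih' := ih (by omega)
    have hn1 : rO (t + 1) ≤ n' := (rankO_mono hOs htE).trans hn
    obtain ⟨hb1, hb2, hb3⟩ := hband t het (by omega)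
    obtain ⟨hb1', hb2', hb3'⟩ := hband (t + 1) (by omega) htE
    have hstep := count_other_step hOs hCs ho hc hresp x (t := t) hn1 hb3' hb3
    have hOs' := hOs t
    have hCs' := hCs t
    -- abbreviations
    set Nt := ((range n').filter fun k => rC t ≤ k ∧ k < rO t ∧ σ (o k) ≠ x).card with hNt
    set Nt1 := ((range n').filter fun k => rC (t + 1) ≤ k ∧ k < rO (t + 1) ∧ σ (o k) ≠ x).card
      with hNt1
    set Bt := ((range t).filter fun u => e < u ∧ σ (u - 1) ≠ x ∧ σ u = x).card with hBt
    set Bt1 := ((range (t + 1)).filter fun u => e < u ∧ σ (u - 1) ≠ x ∧ σ u = x).card with hBt1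
    -- the boundary count at `t + 1`
    have hB : Bt1 = Bt + (if e < t ∧ σ (t - 1) ≠ x ∧ σ t = x then 1 else 0) := by
      rw [hBt1, hBt, range_add_one, filter_insert]
      split_ifs with hcond
      · rw [card_insert_of_notMem (by simp)]
      · rfl
    have hBmono : 2 * m * Bt ≤ 2 * m * Bt1 := Nat.mul_le_mul_left _ (by rw [hB]; omega)
    simp only [Nat.add_sub_cancel]
    by_cases hσt : σ t = x
    · -- time `t` has colour `x`: `N` is frozen, and the indicator at `t + 1` is off
      have hN : Nt1 = Nt := by simpa [hσt] using hstep
      rw [if_neg (not_not.2 hσt), if_neg (not_not.2 hσt)]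
      by_cases hσt1 : σ (t - 1) = x
      · rw [if_neg (not_not.2 hσt1), if_neg (not_not.2 hσt1)] at ih'
        omega
      · -- leaving an `¬x`-run at `t`: bank `q t - (L - m) ≤ 2m`
        rw [if_pos hσt1, if_pos hσt1] at ih'
        have het' : e < t := by
          rcases eq_or_lt_of_le het with rfl | hlt
          · exact absurd hσe hσt1
          · exact hlt
        have hB1 : Bt1 = Bt + 1 := by rw [hB, if_pos ⟨het', hσt1, hσt⟩]
        have h2m : 2 * m * Bt1 = 2 * m * Bt + 2 * m := by rw [hB1, mul_add, mul_one]
        omega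
    · -- time `t` has colour `≠ x`: `N` moves with `q`
      rw [if_pos hσt, if_pos hσt]
      have hN : Nt1 + (if W t = false then 1 else 0) = Nt + (if W t = true then 1 else 0) := by
        simpa [hσt] using hstep
      by_cases hσt1 : σ (t - 1) = x
      · -- entering an `¬x`-run at `t`: free since `q t ≥ L - m`
        rw [if_neg (not_not.2 hσt1), if_neg (not_not.2 hσt1)] at ih'
        cases hW : W t <;> simp [hW] at hN hOs' hCs' <;> omega
      · rw [if_pos hσt1, if_pos hσt1] at ih'
        cases hW : W t <;> simp [hW] at hN hOs' hCs' <;> omega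

include hOs hCs ho hc hresp in
/-- **Between an all-`x` queue and an all-`¬x` queue lie at least `(L − 3m)/(2m)` boundaries
into `x`.**  If at time `e ≥ 1` (with `σ (e−1) = x`) the queue has no arc of colour `≠ x`, at a
later time `s ≤ E` it has no arc of colour `x`, and the lengths stay thick on `[e, E]`, then
`L ≤ 2m · (#{u ∈ (e, s) : σ(u−1) ≠ x ∧ σ u = x} + 1) + m`. [folklore] -/
theorem many_boundaries_of_two_colours (x : Bool) {e s E L m : ℕ} (hes : e ≤ s)
    (hsE : s ≤ E) (hn : rO E ≤ n')
    (hband : ∀ t, e ≤ t → t ≤ E → L ≤ rO t - rC t + m ∧ rO t ≤ rC t + L + m ∧ rC t ≤ rO t)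
    (hσe : σ (e - 1) = x)
    (hNe : ((range n').filter fun k => rC e ≤ k ∧ k < rO e ∧ σ (o k) ≠ x).card = 0)
    (hNs : ∀ k, rC s ≤ k → k < rO s → σ (o k) ≠ x) :
    L ≤ 2 * m * (((range s).filter fun u => e < u ∧ σ (u - 1) ≠ x ∧ σ u = x).card + 1) + m := by
  classical
  have key := count_other_le hOs hCs ho hc hresp x hn hband hσe hNe hes hsE
  have hbs := hband s hes hsE
  -- at time `s` every queue arc is off-colour: `N(s) = q(s)`
  have hNs' : ((range n').filter fun k => rC s ≤ k ∧ k < rO s ∧ σ (o k) ≠ x).card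
      = rO s - rC s := by
    have hset : ((range n').filter fun k => rC s ≤ k ∧ k < rO s ∧ σ (o k) ≠ x)
        = Finset.Ico (rC s) (rO s) := by
      ext k
      simp only [mem_filter, mem_range, Finset.mem_Ico]
      constructor
      · rintro ⟨-, h1, h2, -⟩; exact ⟨h1, h2⟩
      · rintro ⟨h1, h2⟩
        exact ⟨lt_of_lt_of_le h2 ((rankO_mono hOs hsE).trans hn), h1, h2, hNs k h1 h2⟩
    rw [hset, Nat.card_Ico]
  rw [hNs'] at key
  have h2m : 2 * m * (((range s).filter fun u => e < u ∧ σ (u - 1) ≠ x ∧ σ u = x).card + 1)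
      = 2 * m * ((range s).filter fun u => e < u ∧ σ (u - 1) ≠ x ∧ σ u = x).card + 2 * m := by
    rw [mul_add, mul_one]
  split_ifs at key with hσs <;> omega

end AbstractQueue

end Summit.ValiantsHypothesis.ValiantsHypothesis.Theorems.FifoMatching.NNMonotoneHard
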